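import Literature.NumberTheory.Automorphic.ShimuraCurve
import HarnessLib

/-!
# Traces in `Γ₀^D(M) = ι(O¹)` and the injectivity radius of `X₀^D(M)` for `D > 1`
# (Pasten, *Shimura curves and the abc conjecture*, §8.2, case `F = ℚ`)

Everything here is PROVED (theorems only; no definitions, no named facts). This is the
arithmetic input of the norm comparison `‖h‖_∞ ≤ ν ‖h‖₂` (Pasten 2024, Thm. 8.1; the tree's named
fact `Literature.NumberTheory.Automorphic.PastenShimura2024_thm_8_1`, whose analytic half is in
`ShimuraCurveNormComparisonProofs.lean`), for a Shimura curve datum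
`X : ShimuraCurveData D M` (`Literature/NumberTheory/Automorphic/ShimuraCurve.lean`):

* `ShimuraCurveData.exists_intCast_eq_trace` — **every `γ ∈ Γ₀^D(M)` has integral trace**:
  `γ = ι(x)`, `γ⁻¹ = ι(y)` with `x, y` in the Eichler order `O`, which is a finitely generated
  `ℤ`-module, so `tr(γ) · 1 = γ + γ⁻¹ = ι(x + y)` is integral over `ℤ`; and `tr(γ) ∈ ℚ` because
  `ι⁻¹(ℝ·1 + ℝ·γ)` is a commutative `ℚ`-subalgebra of the non-commutative (central, `dim 4`)
  algebra `B`, hence of dimension `≤ 3`, so `1, x, x², x³` are `ℚ`-dependent, and reducing with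
  Cayley–Hamilton `γ² = tr(γ) γ − 1` forces `tr(γ) ∈ ℚ` unless `γ = ±1`.
* `nonempty_algEquiv_matrix_of_mul_self_eq_zero`, `isSplitAt_of_algEquiv_matrix` — a quaternion
  algebra over a field containing a non-zero `n` with `n² = 0` is `≅ M₂(K)` (it acts faithfully on
  the two-dimensional left ideal `B n`), hence is split at every finite place; so for `D > 1`
  (`B` ramified at the primes of `D`) **`B` has no non-zero nilpotents** and `Γ₀^D(M)` **has no
  parabolic elements** (`ShimuraCurveData.mul_self_ne_zero`,
  `ShimuraCurveData.eq_one_or_eq_neg_one_of_sq_trace_eq_four`). This is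
  Pasten's "Since `B` is a division algebra, `Γ̃` contains no non-trivial parabolic elements"
  (proof of Lemma 8.3, p. 29).
* `sq_trace_sub_two_le_two_mul_cosh_dist_smul` — for `g ∈ SL₂(ℝ)` and `z ∈ ℍ`,
  `tr(g)² − 2 ≤ 2 cosh d(z, g z)` (the displacement of a hyperbolic element is at least its
  translation length `2 log |λ_g|`, Pasten §8.2 p. 29: "`d(x, γx) = 2 log|λ_u|`"), by the identity
  `|cz² + (d−a)z − b|² − y²((a+d)² − 4) = (Re(…) + 2cy²)²`.
* `ShimuraCurveData.seven_le_two_mul_cosh_dist_smul` — **the injectivity radius for `F = ℚ`**: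
  if `D > 1` and `Γ₀^D(M)` acts on `ℍ` without fixed points except for `±1`, then every
  `γ ≠ ±1` in it has `|tr γ| ≥ 3`, hence moves every point by at least `arccosh(7/2) ≈ 1.92`:
  `7 ≤ 2 cosh d(z, γ z)`. (Pasten, Lemmas 8.2–8.3 p. 29, proves `ρ_Γ ≥ 1/(2 (log 6n)³)` for
  totally real `F` of degree `n` via Lehmer-type bounds for Salem numbers; over `ℚ` the trace is a
  rational integer and the bound is elementary.)

(`Γ₀^D(M)` is countable: `ShimuraCurveData.countable_Gamma`, tree,
`HypFundamentalDomainVolume.lean`.)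

## References

* H. Pasten, *Shimura curves and the abc conjecture*, J. Number Theory 254 (2024) 214–335 =
  arXiv:1705.09251, §8.2 p. 29 (Lemmas 8.2, 8.3). [PastenShimura2024]
* M.-F. Vignéras, *Arithmétique des algèbres de quaternions*, LNM 800 (1980), Ch. I §1
  (a quaternion algebra is a division algebra or `M₂(K)`), Ch. IV §1. [VignerasLNM800]
-/

noncomputable section

open scoped MatrixGroups TensorProduct
open UpperHalfPlane NumberField IsDedekindDomain

namespace Literature.NumberTheory.Automorphic

/-! ### Displacement of an element of `SL₂(ℝ)` in terms of its trace -/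

/-- **Translation length bound.** For `g ∈ GL₂(ℝ)` with `det g = 1` and `z ∈ ℍ`:
`tr(g)² − 2 ≤ 2 cosh d(z, g • z)` (hyperbolic distance). Writing `g = (a b; c d)`, `z = x + iy`,
one has `2 cosh d(z, gz) = 2 + |c z² + (d − a) z − b|² / y²` and the polynomial identity
`|c z² + (d − a) z − b|² − y² ((a + d)² − 4) = (Re(c z² + (d − a) z − b) + 2 c y²)² ≥ 0`
(using `ad − bc = 1`). For hyperbolic `g` this is `d(z, gz) ≥ 2 log |λ_g|` (Pasten §8.2 p. 29).
[cite: PastenShimura2024, §8.2 p. 29 (displacement `d(x, γx) = 2 log |λ_u|`)] -/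
theorem sq_trace_sub_two_le_two_mul_cosh_dist_smul (g : GL (Fin 2) ℝ) (hg : g.det = 1) (z : ℍ) :
    ((g 0 0 : ℝ) + g 1 1) ^ 2 - 2 ≤ 2 * Real.cosh (dist z (g • z)) := by
  have hdet1 : ((g.det : ℝˣ) : ℝ) = 1 := by rw [hg, Units.val_one]
  have hdet : (g : Matrix (Fin 2) (Fin 2) ℝ).det = 1 := by
    rw [← Matrix.GeneralLinearGroup.val_det_apply, hdet1]
  have hdetpos : 0 < ((g.det : ℝˣ) : ℝ) := by rw [hdet1]; exact one_pos
  have had : (g 0 0 : ℝ) * g 1 1 - g 0 1 * g 1 0 = 1 := by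
    rw [Matrix.det_fin_two] at hdet
    exact hdet
  rw [UpperHalfPlane.cosh_dist]
  have hw : ((g • z : ℍ) : ℂ) = num g z / denom g z := coe_smul_of_det_pos hdetpos z
  have him : (g • z).im = z.im / Complex.normSq (denom g z) := by
    rw [im_smul_eq_div_normSq]
    have habs : |((g.det : ℝˣ) : ℝ)| = 1 := by rw [hdet1, abs_one]
    rw [habs, one_mul]
  have hD : denom g z ≠ 0 := denom_ne_zero g z
  have hDpos : 0 < Complex.normSq (denom g z) := Complex.normSq_pos.mpr hD
  have hy : 0 < z.im := z.im_pos
  rw [Complex.dist_eq, him, hw]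
  have e1 : ‖(z : ℂ) - num g z / denom g z‖ ^ 2 =
      Complex.normSq ((z : ℂ) * denom g z - num g z) / Complex.normSq (denom g z) := by
    rw [← Complex.normSq_eq_norm_sq, ← Complex.normSq_div]
    congr 1
    field_simp
  rw [e1]
  set Q : ℂ := (z : ℂ) * denom g z - num g z with hQ
  have e2 : Complex.normSq Q / Complex.normSq (denom g z) /
      (2 * z.im * (z.im / Complex.normSq (denom g z))) = Complex.normSq Q / (2 * z.im ^ 2) := by
    field_simp
  rw [e2]
  have hre : Q.re = (g 1 0 : ℝ) * (z.re ^ 2 - z.im ^ 2) + ((g 1 1 : ℝ) - g 0 0) * z.re - g 0 1 := by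
    simp only [hQ, num, denom, Complex.sub_re, Complex.mul_re, Complex.add_re, Complex.ofReal_re,
      Complex.ofReal_im, Complex.mul_im, Complex.add_im, UpperHalfPlane.coe_re,
      UpperHalfPlane.coe_im]
    ring
  have himQ : Q.im = z.im * (2 * (g 1 0 : ℝ) * z.re + g 1 1 - g 0 0) := by
    simp only [hQ, num, denom, Complex.sub_im, Complex.mul_re, Complex.add_re, Complex.ofReal_re,
      Complex.ofReal_im, Complex.mul_im, Complex.add_im, UpperHalfPlane.coe_re,
      UpperHalfPlane.coe_im]
    ring
  have key : Complex.normSq Q - z.im ^ 2 * (((g 0 0 : ℝ) + g 1 1) ^ 2 - 4) =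
      (Q.re + 2 * (g 1 0 : ℝ) * z.im ^ 2) ^ 2 := by
    rw [Complex.normSq_apply, hre, himQ]
    linear_combination (-4 * z.im ^ 2) * had
  have h3 : z.im ^ 2 * (((g 0 0 : ℝ) + g 1 1) ^ 2 - 4) ≤ Complex.normSq Q := by
    nlinarith [key, sq_nonneg (Q.re + 2 * (g 1 0 : ℝ) * z.im ^ 2)]
  have hy2 : 0 < z.im ^ 2 := by positivity
  have h4 : ((g 0 0 : ℝ) + g 1 1) ^ 2 - 4 ≤ Complex.normSq Q / z.im ^ 2 := by
    rw [le_div_iff₀ hy2]; linarith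
  have h5 : 2 * (1 + Complex.normSq Q / (2 * z.im ^ 2)) = 2 + Complex.normSq Q / z.im ^ 2 := by
    field_simp
  rw [h5]; linarith

/-! ### Cayley–Hamilton in `SL₂(ℝ)` -/

/-- Cayley–Hamilton for a real `2 × 2` matrix of determinant `1`: `G² = tr(G) G − 1`. [folklore] -/
theorem mul_self_eq_trace_smul_sub_one {G : Matrix (Fin 2) (Fin 2) ℝ} (hG : G.det = 1) :
    G * G = G.trace • G - 1 := by
  rw [Matrix.det_fin_two] at hG
  ext i j
  fin_cases i <;> fin_cases j <;>
    simp [Matrix.mul_apply, Fin.sum_univ_two, Matrix.trace_fin_two] <;>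
    first | ring1 | linear_combination (-1 : ℝ) * hG

/-- For `det γ = 1`: `γ + γ⁻¹ = tr(γ) · 1` (the adjugate formula). [folklore] -/
theorem coe_add_coe_inv_eq {γ : GL (Fin 2) ℝ} (hγ : (γ : Matrix (Fin 2) (Fin 2) ℝ).det = 1) :
    (γ : Matrix (Fin 2) (Fin 2) ℝ) + ((γ⁻¹ : GL (Fin 2) ℝ) : Matrix (Fin 2) (Fin 2) ℝ) =
      algebraMap ℝ (Matrix (Fin 2) (Fin 2) ℝ) (γ : Matrix (Fin 2) (Fin 2) ℝ).trace := by
  have hinv : (γ : Matrix (Fin 2) (Fin 2) ℝ)⁻¹ =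
      (γ : Matrix (Fin 2) (Fin 2) ℝ).trace • (1 : Matrix (Fin 2) (Fin 2) ℝ) - γ := by
    apply Matrix.inv_eq_right_inv
    rw [mul_sub, mul_smul_comm, mul_one, mul_self_eq_trace_smul_sub_one hγ]
    abel
  rw [Matrix.coe_units_inv, hinv, Algebra.algebraMap_eq_smul_one]
  abel

/-! ### A quaternion algebra with a non-zero nilpotent is `M₂(K)` -/

/-- **A quaternion algebra containing `n ≠ 0` with `n² = 0` is a matrix algebra.** The left ideal
`I = B n` satisfies `I ⊆ Ann(n)`, so `dim I ≤ 2` by rank–nullity; `B` is simple, so the left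
regular action `B → End_K(I)` is injective and `4 ≤ (dim I)²`; hence `dim I = 2` and
`B ≅ End_K(I) ≅ M₂(K)`. (Vignéras I §1: a quaternion algebra is either a division algebra or
`M₂(K)`.) [cite: VignerasLNM800, Ch. I §1 (Thm. 1.2.3: `H` is a field or `M(2, K)`)] -/
theorem nonempty_algEquiv_matrix_of_mul_self_eq_zero {K B : Type*} [Field K] [Ring B] [Algebra K B]
    [IsQuaternionAlgebra K B] {n : B} (hn : n ≠ 0) (hn2 : n * n = 0) :
    Nonempty (B ≃ₐ[K] Matrix (Fin 2) (Fin 2) K) := by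
  haveI := IsQuaternionAlgebra.isSimpleRing' K B
  have h4 : Module.finrank K B = 4 := IsQuaternionAlgebra.finrank_eq_four (K := K) (D := B)
  -- the left ideal `B n`
  let I : Ideal B := Ideal.span {n}
  let φ : B →ₗ[K] B := LinearMap.mulRight K n
  have hIφ : I.restrictScalars K = LinearMap.range φ := by
    ext b
    simp only [Submodule.restrictScalars_mem, LinearMap.mem_range, I, φ, LinearMap.mulRight_apply,
      Ideal.mem_span_singleton']
  have hdI : Module.finrank K I = Module.finrank K (LinearMap.range φ) := by
    rw [← hIφ]; rfl
  -- `dim (B n) ≤ 2`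
  have hle : LinearMap.range φ ≤ LinearMap.ker φ := by
    rintro _ ⟨b, rfl⟩
    simp only [LinearMap.mem_ker, φ, LinearMap.mulRight_apply, mul_assoc, hn2, mul_zero]
  have hsum := LinearMap.finrank_range_add_finrank_ker φ
  have hle' := Submodule.finrank_mono hle
  have hd2 : Module.finrank K I ≤ 2 := by rw [hdI]; omega
  -- the left regular representation on `I`
  let ρ : B →ₐ[K] Module.End K I := Algebra.lsmul K K I
  haveI hI0 : Nontrivial I := by
    refine ⟨⟨⟨n, Ideal.subset_span rfl⟩, 0, ?_⟩⟩
    intro h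
    exact hn (congrArg Subtype.val h)
  have hρ : Function.Injective ρ := ρ.toRingHom.injective
  have hEnd : Module.finrank K (Module.End K I) = Module.finrank K I * Module.finrank K I :=
    Module.finrank_linearMap K K I I
  have hle4 : 4 ≤ Module.finrank K I * Module.finrank K I := by
    rw [← h4, ← hEnd]
    exact LinearMap.finrank_le_finrank_of_injective (f := ρ.toLinearMap) hρ
  have hd : Module.finrank K I = 2 := by
    rcases Nat.lt_or_ge (Module.finrank K I) 2 with h | h
    · interval_cases (Module.finrank K I) <;> omega
    · omega
  have hdim : Module.finrank K B = Module.finrank K (Module.End K I) := by rw [hEnd, hd, h4]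
  have hbij : Function.Bijective ρ :=
    ⟨hρ, (LinearMap.injective_iff_surjective_of_finrank_eq_finrank hdim (f := ρ.toLinearMap)).mp hρ⟩
  let b : Module.Basis (Fin 2) K I := Module.finBasisOfFinrankEq K I hd
  exact ⟨(AlgEquiv.ofBijective ρ hbij).trans (LinearMap.toMatrixAlgEquiv b)⟩

/-- **`M₂(K)` is split at every finite place**: an isomorphism `B ≅ M₂(K)` gives
`B ⊗_K K_v ≅ K_v ⊗_K M₂(K) ≅ M₂(K_v)` as `K_v`-algebras (tree `IsSplitAt`). [folklore] -/
theorem isSplitAt_of_algEquiv_matrix {K : Type} [Field K] [NumberField K] {B : Type*} [Ring B]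
    [Algebra K B] (e : B ≃ₐ[K] Matrix (Fin 2) (Fin 2) K) (v : HeightOneSpectrum (𝓞 K)) :
    IsSplitAt B v := by
  let Kv := v.adicCompletion K
  let e1 : Kv ⊗[K] B ≃ₐ[Kv] Kv ⊗[K] Matrix (Fin 2) (Fin 2) K :=
    Algebra.TensorProduct.congr AlgEquiv.refl e
  let e2 : Kv ⊗[K] Matrix (Fin 2) (Fin 2) K ≃ₐ[Kv] Matrix (Fin 2) (Fin 2) Kv :=
    AlgEquiv.ofRingEquiv (f := (matrixEquivTensor (Fin 2) K Kv).symm.toRingEquiv) (fun x => by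
      change (matrixEquivTensor (Fin 2) K Kv).symm (x ⊗ₜ 1) = _
      rw [matrixEquivTensor_apply_symm, Matrix.map_one _ (map_zero _) (map_one _),
        Algebra.algebraMap_eq_smul_one])
  exact ⟨((ScalarExtension.ofTensor K Kv B).symm.trans e1).trans e2⟩

/-! ### Traces in `Γ₀^D(M)` -/

namespace ShimuraCurveData

variable {D M : ℕ} (X : ShimuraCurveData D M)

/-- Elements of the Eichler order are integral over `ℤ` (`O` is a subring of `B` finitely generated
as a `ℤ`-module). [folklore] -/
theorem isIntegral_of_mem_O {x : X.B} (hx : x ∈ X.O) : IsIntegral ℤ x := by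
  let S : Subalgebra ℤ X.B :=
    { carrier := X.O
      mul_mem' := fun ha hb => X.isOrder.mul_mem _ ha _ hb
      one_mem' := X.isOrder.one_mem
      add_mem' := fun ha hb => X.O.add_mem ha hb
      zero_mem' := X.O.zero_mem
      algebraMap_mem' := fun n => by
        rw [Algebra.algebraMap_eq_smul_one]
        exact X.O.smul_mem n X.isOrder.one_mem }
  have hS : S.toSubmodule = X.O := by
    ext b; rfl
  exact IsIntegral.of_mem_of_fg S (hS ▸ X.isOrder.isFullLattice.1) x hx

/-- The quaternion algebra of a datum is not commutative (it is central of dimension `4`).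
[folklore] -/
theorem exists_mul_ne_mul : ∃ p q : X.B, p * q ≠ q * p := by
  haveI : Nontrivial X.B := Module.nontrivial_of_finrank_pos (R := ℚ)
    (by rw [IsQuaternionAlgebra.finrank_eq_four (K := ℚ) (D := X.B)]; norm_num)
  by_contra h
  push Not at h
  have hcen : Subalgebra.center ℚ X.B = ⊤ := by
    rw [eq_top_iff]
    intro b _
    rw [Subalgebra.mem_center_iff]
    intro c
    exact h c b
  have hbot : Subalgebra.center ℚ X.B = ⊥ := Algebra.IsCentral.center_eq_bot ℚ X.B
  have h4 : Module.finrank ℚ X.B = 4 := IsQuaternionAlgebra.finrank_eq_four (K := ℚ) (D := X.B)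
  have h1 : Module.finrank ℚ X.B = 1 :=
    Subalgebra.bot_eq_top_iff_finrank_eq_one.mp (hbot.symm.trans hcen)
  omega

/-- An element of `Γ₀^D(M)` has determinant `1` (as a real matrix). [folklore] -/
theorem det_coe_eq_one {γ : GL (Fin 2) ℝ} (hγ : γ ∈ X.Gamma) :
    (γ : Matrix (Fin 2) (Fin 2) ℝ).det = 1 := by
  rw [← Matrix.GeneralLinearGroup.val_det_apply, hγ.2.2, Units.val_one]

/-- **The trace of an element of `Γ₀^D(M)` is an algebraic integer**: `tr(γ) · 1 = γ + γ⁻¹ =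
ι(x + y)` with `x, y ∈ O`. [folklore] -/
theorem isIntegral_trace {γ : GL (Fin 2) ℝ} (hγ : γ ∈ X.Gamma) :
    IsIntegral ℤ (γ : Matrix (Fin 2) (Fin 2) ℝ).trace := by
  have hdet := X.det_coe_eq_one hγ
  obtain ⟨⟨x, hx, hxγ⟩, ⟨y, hy, hyγ⟩, -⟩ := hγ
  have hsum : IsIntegral ℤ (X.ι (x + y)) := (X.isIntegral_of_mem_O (X.O.add_mem hx hy)).map X.ι
  rw [map_add, hxγ, hyγ, coe_add_coe_inv_eq hdet] at hsum
  exact (isIntegral_algebraMap_iff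
    (algebraMap ℝ (Matrix (Fin 2) (Fin 2) ℝ)).injective).mp hsum

/-- **The trace of an element of `Γ₀^D(M)` is rational.** If `γ = ι(x)` is not `±1`-scalar, the
preimage under `ι` of the commutative real algebra `ℝ·1 + ℝ·γ` is a commutative `ℚ`-subalgebra of
the non-commutative `4`-dimensional `B`, so of dimension `≤ 3` and containing `1, x, x², x³`; a
non-trivial `ℚ`-relation between these, reduced with `γ² = tr(γ)γ − 1`, makes `tr(γ)` rational.
[folklore] -/
theorem exists_ratCast_eq_trace {γ : GL (Fin 2) ℝ} (hγ : γ ∈ X.Gamma) :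
    ∃ q : ℚ, (q : ℝ) = (γ : Matrix (Fin 2) (Fin 2) ℝ).trace := by
  have hdet := X.det_coe_eq_one hγ
  obtain ⟨⟨x, hx, hxγ⟩, -, -⟩ := hγ
  set G : Matrix (Fin 2) (Fin 2) ℝ := (γ : Matrix (Fin 2) (Fin 2) ℝ) with hGdef
  set t : ℝ := G.trace with htdef
  have hCH : G * G = t • G - 1 := mul_self_eq_trace_smul_sub_one hdet
  by_cases hsc : G 0 1 = 0 ∧ G 1 0 = 0 ∧ G 0 0 = G 1 1
  · -- scalar case: `G = ±1`
    obtain ⟨h01, h10, h00⟩ := hsc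
    rw [Matrix.det_fin_two, h01, ← h00, zero_mul, sub_zero] at hdet
    rcases mul_self_eq_one_iff.mp hdet with h | h
    · exact ⟨2, by rw [htdef, Matrix.trace_fin_two, ← h00, h]; norm_num⟩
    · exact ⟨-2, by rw [htdef, Matrix.trace_fin_two, ← h00, h]; norm_num⟩
  · -- non-scalar case
    let S : Submodule ℝ (Matrix (Fin 2) (Fin 2) ℝ) := Submodule.span ℝ {1, G}
    have hS : ∀ m ∈ S, ∀ m' ∈ S, m * m' ∈ S ∧ m * m' = m' * m := by
      intro m hm m' hm'
      rw [Submodule.mem_span_pair] at hm hm'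
      obtain ⟨u, v, rfl⟩ := hm
      obtain ⟨u', v', rfl⟩ := hm'
      have e1 : (u • (1 : Matrix (Fin 2) (Fin 2) ℝ) + v • G) * (u' • 1 + v' • G) =
          (u * u' - v * v') • (1 : Matrix (Fin 2) (Fin 2) ℝ) +
            (u * v' + v * u' + v * v' * t) • G := by
        simp only [add_mul, mul_add, smul_mul_assoc, mul_smul_comm, one_mul, mul_one, hCH,
          smul_sub, smul_smul]
        module
      have e2 : (u' • (1 : Matrix (Fin 2) (Fin 2) ℝ) + v' • G) * (u • 1 + v • G) =
          (u * u' - v * v') • (1 : Matrix (Fin 2) (Fin 2) ℝ) +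
            (u * v' + v * u' + v * v' * t) • G := by
        simp only [add_mul, mul_add, smul_mul_assoc, mul_smul_comm, one_mul, mul_one, hCH,
          smul_sub, smul_smul]
        module
      refine ⟨?_, e1.trans e2.symm⟩
      rw [e1, Submodule.mem_span_pair]
      exact ⟨_, _, rfl⟩
    have h1S : (1 : Matrix (Fin 2) (Fin 2) ℝ) ∈ S := Submodule.subset_span (by simp)
    have hGS : G ∈ S := Submodule.subset_span (by simp)
    have hGpow : ∀ n : ℕ, G ^ n ∈ S := by
      intro n
      induction n with
      | zero => rw [pow_zero]; exact h1S
      | succ n ih => rw [pow_succ]; exact (hS _ ih _ hGS).1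
    let V : Submodule ℚ X.B := (S.restrictScalars ℚ).comap X.ι.toLinearMap
    have hVmem : ∀ b : X.B, b ∈ V ↔ X.ι b ∈ S := fun b => Iff.rfl
    have h4 : Module.finrank ℚ X.B = 4 := IsQuaternionAlgebra.finrank_eq_four (K := ℚ) (D := X.B)
    have hVlt : V < ⊤ := by
      obtain ⟨p, q, hpq⟩ := X.exists_mul_ne_mul
      rw [lt_top_iff_ne_top]
      intro hV
      have hp : X.ι p ∈ S := (hVmem p).mp (hV ▸ Submodule.mem_top)
      have hq : X.ι q ∈ S := (hVmem q).mp (hV ▸ Submodule.mem_top)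
      exact hpq (X.ι_injective (by rw [map_mul, map_mul]; exact (hS _ hp _ hq).2))
    have hfin : Module.finrank ℚ V < 4 := h4 ▸ Submodule.finrank_lt hVlt.ne
    have hxpow : ∀ n : ℕ, x ^ n ∈ V := fun n =>
      (hVmem _).mpr (by rw [map_pow, hxγ]; exact hGpow n)
    let f : Fin 4 → V := fun i => ⟨x ^ (i : ℕ), hxpow i⟩
    have hdep : ¬ LinearIndependent ℚ f := by
      intro hli
      have := hli.fintype_card_le_finrank
      rw [Fintype.card_fin] at this
      omega
    rw [Fintype.not_linearIndependent_iff] at hdep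
    obtain ⟨c, hc0, i₀, hi₀⟩ := hdep
    have hsumB : ∑ i, c i • x ^ (i : ℕ) = 0 := by
      have := congrArg Subtype.val hc0
      simpa [f] using this
    have hsumM : ∑ i : Fin 4, ((c i : ℚ) : ℝ) • G ^ (i : ℕ) = 0 := by
      have := congrArg X.ι hsumB
      rw [map_sum, map_zero] at this
      rw [← this]
      refine Finset.sum_congr rfl fun i _ => ?_
      rw [map_smul, map_pow, hxγ, ← algebraMap_smul ℝ (c i), eq_ratCast]
    have hG2 : G ^ 2 = t • G - 1 := by rw [sq, hCH]
    have hG3 : G ^ 3 = (t * t - 1) • G - t • (1 : Matrix (Fin 2) (Fin 2) ℝ) := by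
      rw [pow_succ, hG2, sub_mul, smul_mul_assoc, hCH, one_mul, smul_sub, smul_smul]
      module
    rw [Fin.sum_univ_four] at hsumM
    simp only [Fin.val_zero, Fin.val_one, Fin.val_two, pow_zero, pow_one, hG2] at hsumM
    have hv3 : ((3 : Fin 4) : ℕ) = 3 := rfl
    rw [hv3, hG3] at hsumM
    set α : ℝ := (c 0 : ℝ) - c 2 - c 3 * t with hα
    set β : ℝ := (c 1 : ℝ) + c 2 * t + c 3 * (t * t - 1) with hβ
    have hcomb : α • (1 : Matrix (Fin 2) (Fin 2) ℝ) + β • G = 0 := by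
      rw [← hsumM, hα, hβ]
      module
    have e00 := congrFun (congrFun hcomb 0) 0
    have e01 := congrFun (congrFun hcomb 0) 1
    have e10 := congrFun (congrFun hcomb 1) 0
    have e11 := congrFun (congrFun hcomb 1) 1
    simp only [Matrix.add_apply, Matrix.smul_apply, Matrix.one_apply_eq, Matrix.one_apply_ne,
      ne_eq, zero_ne_one, one_ne_zero, not_false_eq_true, smul_eq_mul, mul_one, mul_zero,
      zero_add, Matrix.zero_apply] at e00 e01 e10 e11
    have hβ0 : β = 0 := by
      by_contra hb
      apply hsc
      refine ⟨(mul_eq_zero.mp e01).resolve_left hb, (mul_eq_zero.mp e10).resolve_left hb, ?_⟩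
      have : β * (G 0 0 - G 1 1) = 0 := by linear_combination e00 - e11
      exact sub_eq_zero.mp ((mul_eq_zero.mp this).resolve_left hb)
    have hα0 : α = 0 := by
      rw [hβ0, zero_mul, add_zero] at e00
      exact e00
    by_cases h3 : c 3 = 0
    · by_cases h2 : c 2 = 0
      · exfalso
        have h0 : c 0 = 0 := by
          have : ((c 0 : ℚ) : ℝ) = 0 := by rw [← hα0, hα, h2, h3]; push_cast; ring
          exact_mod_cast this
        have h1 : c 1 = 0 := by
          have : ((c 1 : ℚ) : ℝ) = 0 := by rw [← hβ0, hβ, h2, h3]; push_cast; ring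
          exact_mod_cast this
        apply hi₀
        fin_cases i₀ <;> assumption
      · refine ⟨-c 1 / c 2, ?_⟩
        have h2' : ((c 2 : ℚ) : ℝ) ≠ 0 := by exact_mod_cast h2
        have : ((c 1 : ℚ) : ℝ) + c 2 * t = 0 := by rw [← hβ0, hβ, h3]; push_cast; ring
        push_cast
        rw [div_eq_iff h2']
        linear_combination (-1 : ℝ) * this
    · refine ⟨(c 0 - c 2) / c 3, ?_⟩
      have h3' : ((c 3 : ℚ) : ℝ) ≠ 0 := by exact_mod_cast h3
      have : ((c 0 : ℚ) : ℝ) - c 2 - c 3 * t = 0 := by rw [← hα0, hα]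
      push_cast
      rw [div_eq_iff h3']
      linear_combination this

/-- **The trace of an element of `Γ₀^D(M)` is a rational integer** (rational and integral over
`ℤ`). For `F = ℚ` this replaces Pasten's Lemma 8.2 (iii)–(iv) (`λ_β ∈ O_K^×`, `[K:F] = 2`).
[cite: PastenShimura2024, §8.2 Lemma 8.2 p. 29] -/
theorem exists_intCast_eq_trace {γ : GL (Fin 2) ℝ} (hγ : γ ∈ X.Gamma) :
    ∃ n : ℤ, (n : ℝ) = (γ : Matrix (Fin 2) (Fin 2) ℝ).trace := by
  obtain ⟨q, hq⟩ := X.exists_ratCast_eq_trace hγ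
  have hint := X.isIntegral_trace hγ
  rw [← hq] at hint
  have hq' : IsIntegral ℤ q := by
    refine (isIntegral_algebraMap_iff (algebraMap ℚ ℝ).injective).mp ?_
    rwa [eq_ratCast]
  obtain ⟨n, hn⟩ := IsIntegrallyClosed.isIntegral_iff.mp hq'
  refine ⟨n, ?_⟩
  rw [← hq, ← hn, eq_intCast, Rat.cast_intCast]

/-- **For `D > 1` the quaternion algebra of a datum has no non-zero element of square zero**: it
is ramified at the primes dividing `D` (`ramifiedPlaces_eq`), whereas an algebra with a non-zero
nilpotent is `≅ M₂(ℚ)`, split everywhere. (Pasten, proof of Lemma 8.3 p. 29: "Since `B` is a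
division algebra …".) [cite: PastenShimura2024, §8.2, proof of Lemma 8.3 p. 29] -/
theorem mul_self_ne_zero (hD : 1 < D) {n : X.B} (hn : n ≠ 0) : n * n ≠ 0 := by
  intro hn2
  obtain ⟨e⟩ := nonempty_algEquiv_matrix_of_mul_self_eq_zero (K := ℚ) hn hn2
  obtain ⟨p, hp, hpD⟩ := Nat.exists_prime_and_dvd hD.ne'
  let v : HeightOneSpectrum (𝓞 ℚ) := Rat.HeightOneSpectrum.primesEquiv.symm ⟨p, hp⟩
  have hv : v ∈ ramifiedPlaces ℚ X.B := by
    rw [X.ramifiedPlaces_eq]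
    show ((Rat.HeightOneSpectrum.primesEquiv v : Nat.Primes) : ℕ) ∣ D
    simp [v, hpD]
  exact hv (isSplitAt_of_algEquiv_matrix e v)

/-- **No elliptic elements**: if only `±1` have fixed points in `ℍ`, then `tr(γ)² ≥ 4` for every
`γ ∈ Γ₀^D(M)` (an element of `SL₂(ℝ)` with `tr² < 4` is elliptic and fixes Mathlib's
`UpperHalfPlane.fixedPt`). [folklore] -/
theorem four_le_sq_trace (hfree : ∀ γ ∈ X.Gamma, (∃ z : ℍ, γ • z = z) → γ = 1 ∨ γ = -1)
    {γ : GL (Fin 2) ℝ} (hγ : γ ∈ X.Gamma) : 4 ≤ (γ : Matrix (Fin 2) (Fin 2) ℝ).trace ^ 2 := by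
  by_contra hlt
  push Not at hlt
  have hdet := X.det_coe_eq_one hγ
  have hell : γ.IsElliptic := by
    change (γ : Matrix (Fin 2) (Fin 2) ℝ).discr < 0
    rw [Matrix.discr_fin_two, hdet]
    linarith
  have hpos : 0 < (γ : Matrix (Fin 2) (Fin 2) ℝ).det := by rw [hdet]; exact one_pos
  have hfix : γ • UpperHalfPlane.fixedPt γ hell = UpperHalfPlane.fixedPt γ hell :=
    (UpperHalfPlane.gl_smul_eq_self_iff_eq_fixedPt hpos hell).mpr rfl
  rcases hfree γ hγ ⟨_, hfix⟩ with rfl | rfl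
  · norm_num [Matrix.trace_fin_two] at hlt
  · norm_num [Matrix.trace_fin_two] at hlt

/-- **No parabolic elements for `D > 1`**: `γ ∈ Γ₀^D(M)` with `tr(γ)² = 4` is `±1`. Indeed for
`γ = ι(x)` with `tr γ = ±2`, Cayley–Hamilton gives `(x ∓ 1)² = 0` in `B`, so `x = ±1` by
`mul_self_ne_zero`. [cite: PastenShimura2024, §8.2, proof of Lemma 8.3 p. 29] -/
theorem eq_one_or_eq_neg_one_of_sq_trace_eq_four (hD : 1 < D) {γ : GL (Fin 2) ℝ}
    (hγ : γ ∈ X.Gamma) (ht : (γ : Matrix (Fin 2) (Fin 2) ℝ).trace ^ 2 = 4) : γ = 1 ∨ γ = -1 := by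
  have hdet := X.det_coe_eq_one hγ
  obtain ⟨⟨x, hx, hxγ⟩, -, -⟩ := hγ
  have hCH := mul_self_eq_trace_smul_sub_one hdet
  have ht' : (γ : Matrix (Fin 2) (Fin 2) ℝ).trace = 2 ∨ (γ : Matrix (Fin 2) (Fin 2) ℝ).trace = -2 := by
    have h : ((γ : Matrix (Fin 2) (Fin 2) ℝ).trace - 2) * ((γ : Matrix (Fin 2) (Fin 2) ℝ).trace + 2)
        = 0 := by linear_combination ht
    rcases mul_eq_zero.mp h with h | h
    · left; linarith
    · right; linarith
  rcases ht' with ht | ht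
  · left
    rw [ht] at hCH
    have hsq : (x - 1) * (x - 1) = 0 := X.ι_injective (by
      rw [map_mul, map_sub, map_one, map_zero, hxγ, sub_mul, mul_sub, one_mul, mul_one, hCH,
        two_smul]
      abel)
    have hx1 : x - 1 = 0 := by
      by_contra hne
      exact X.mul_self_ne_zero hD hne hsq
    rw [sub_eq_zero] at hx1
    rw [hx1, map_one] at hxγ
    exact Units.val_eq_one.mp hxγ.symm
  · right
    rw [ht] at hCH
    have hsq : (x + 1) * (x + 1) = 0 := X.ι_injective (by
      rw [map_mul, map_add, map_one, map_zero, hxγ, add_mul, mul_add, one_mul, mul_one, hCH,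
        _root_.neg_smul, two_smul]
      abel)
    have hx1 : x + 1 = 0 := by
      by_contra hne
      exact X.mul_self_ne_zero hD hne hsq
    rw [add_eq_zero_iff_eq_neg] at hx1
    rw [hx1, map_neg, map_one] at hxγ
    ext i j
    have := congrFun (congrFun hxγ i) j
    simpa using this.symm

/-- **`|tr γ| ≥ 3` for `γ ≠ ±1`** (`D > 1`, no fixed points except for `±1`): the trace is a
rational integer with `tr² ≥ 4` and `tr² ≠ 4`. [cite: PastenShimura2024, §8.2 Lemmas 8.2–8.3 p. 29] -/
theorem nine_le_sq_trace (hD : 1 < D)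
    (hfree : ∀ γ ∈ X.Gamma, (∃ z : ℍ, γ • z = z) → γ = 1 ∨ γ = -1)
    {γ : GL (Fin 2) ℝ} (hγ : γ ∈ X.Gamma) (h1 : γ ≠ 1) (h2 : γ ≠ -1) :
    9 ≤ (γ : Matrix (Fin 2) (Fin 2) ℝ).trace ^ 2 := by
  obtain ⟨n, hn⟩ := X.exists_intCast_eq_trace hγ
  have h4 := X.four_le_sq_trace hfree hγ
  have hne : (γ : Matrix (Fin 2) (Fin 2) ℝ).trace ^ 2 ≠ 4 := fun h => by
    rcases X.eq_one_or_eq_neg_one_of_sq_trace_eq_four hD hγ h with rfl | rfl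
    · exact h1 rfl
    · exact h2 rfl
  rw [← hn] at h4 hne ⊢
  have h4' : 4 ≤ n ^ 2 := by exact_mod_cast h4
  have hne' : n ^ 2 ≠ 4 := by exact_mod_cast hne
  have h9 : 9 ≤ n ^ 2 := by
    by_contra hlt
    push Not at hlt
    have habs : |n| < 3 := by
      by_contra hge
      push Not at hge
      have : (3 : ℤ) ^ 2 ≤ |n| ^ 2 := pow_le_pow_left₀ (by norm_num) hge 2
      rw [sq_abs] at this
      omega
    have habs2 : 2 ≤ |n| := by
      by_contra hlt2
      push Not at hlt2
      have : |n| ^ 2 < 2 ^ 2 := pow_lt_pow_left₀ hlt2 (abs_nonneg n) two_ne_zero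
      rw [sq_abs] at this
      omega
    have : |n| = 2 := by omega
    apply hne'
    rw [← sq_abs, this]; norm_num
  exact_mod_cast h9

/-- **The injectivity radius of `X₀^D(M)` over `ℚ`** (Pasten Thm. 8.1's geometric input, the
case `F = ℚ` of Lemmas 8.2–8.3): for `D > 1`, if `Γ₀^D(M)` acts on `ℍ` without fixed points
except for `±1`, then every `γ ≠ ±1` in it moves every point of `ℍ` by at least `arccosh (7/2)`:
`7 ≤ 2 cosh d(z, γ • z)`. [cite: PastenShimura2024, §8.2 Lemma 8.3 p. 29 (case `n = 1`)] -/
theorem seven_le_two_mul_cosh_dist_smul (hD : 1 < D)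
    (hfree : ∀ γ ∈ X.Gamma, (∃ z : ℍ, γ • z = z) → γ = 1 ∨ γ = -1)
    {γ : GL (Fin 2) ℝ} (hγ : γ ∈ X.Gamma) (h1 : γ ≠ 1) (h2 : γ ≠ -1) (z : ℍ) :
    7 ≤ 2 * Real.cosh (dist z (γ • z)) := by
  have h9 := X.nine_le_sq_trace hD hfree hγ h1 h2
  have h := sq_trace_sub_two_le_two_mul_cosh_dist_smul γ hγ.2.2 z
  rw [← Matrix.trace_fin_two] at h
  linarith

end ShimuraCurveData

end Literature.NumberTheory.Automorphic

end
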